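import Summits.NavierStokesRegularity.NavierStokesRegularity.Theses.PumpContinuation
import Summits.NavierStokesRegularity.NavierStokesRegularity.Theorems.BoundedTemperatureClosed.Negative.TemperatureFloor
import Literature.Analysis.FluidPDE.SelfSimilar
import Literature.Analysis.FluidPDE.AncientMildDrift

/-!
# Crux triage r1-1 (refuter) · crux `BoundedTemperatureClosed` (stmt-NavierStokesRegularity-18303)
# KNSS parasitic drifts kill the `θ = 1` stubs of the `k = 2` idea cards AS TYPED

The two Navier–Stokes-side hard stubs typed in `Cruxes/BoundedTemperatureClosed/SketchIdeator2.lean`,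
`IgnitionWithLossNS` (card `closed-shadow`, its transferred statement) and `HeteroclinicRigidityNS`
(card `recycle-track-shoot`, its codimension-0 exit stub), quantify over the class
`IsAncientMildSolution 1 U ∧ (U smooth on t < 0) ∧ HasTypeITimeDecay M U ∧ U ≢ 0`.
That class contains KNSS's parasitic drifts `U(t, x) = b(t)` (in tree:
`Literature.Analysis.FluidPDE.isAncientMildSolution_timeConst`, KNSS 2009 §1 p. 3) at EVERY positive
temperature. Consequences (both sorry-free; defs copied VERBATIM from `SketchIdeator2.lean`, which is not an
importable module):

* `not_ignitionWithLossNS` — igniting the drift `(a/√(-t)) e₀`, `a = c/4`, with loss `η = a` would give a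
  Schwartz-data `H¹⁰_df`-mild Navier–Stokes Type-I blow-up of ceiling `c/2`, contradicting the LANDED
  temperature floor `typeI_constant_ge` (Leray 1934 in Tao's mild class, `Negative/TemperatureFloor.lean`,
  p149636): `¬ IgnitionWithLossNS` unconditionally.
* `not_heteroclinicRigidityNS` — `U = (−t)^{-1/2} e₀`, `W = (−t)^{-1/2} e₀ + (1−t)^{-1/2} e₁`, `M = 2`,
  `c_k = 1/(k+1)`: `W` emanates from `U` in the typed sense (`c_k W(c_k² t, c_k x) → U` uniformly on
  `t < 0`), yet `W` is no symmetry image of `U` (it has an `e₁`-component): `¬ HeteroclinicRigidityNS`.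

Classification: stub-misstated (junk model). Repair that the witnesses miss: replace `HasTypeITimeDecay M U`
by the space–time Type-I decay `HasTypeIDecay M U` (`‖U(t,x)‖ ≤ M/(‖x‖ + √(−t))`, KNSS (1.6)), or work in
KNSS's Oseen-kernel mild class / bounded class modulo parasitic solutions. The lesson is not cosmetic for
these cards: their zoom limits are taken under an `L^∞`-in-time ceiling only, which is exactly the regime
in which drift-dressed objects appear (ideator-2 notes BN1/BN2, "teleporting NS").
-/

noncomputable section

open MeasureTheory Set Filter Topology Function
open scoped ENNReal
open Literature.Analysis.FluidPDE Literature.Analysis.FluidPDE.Tao2016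

set_option linter.dupNamespace false

namespace Summit.NavierStokesRegularity.NavierStokesRegularity.Cruxes.BoundedTemperatureClosed.TriageR1K1

local notation "ℝ³" => EuclideanSpace ℝ (Fin 3)

/-! ### The two stubs, verbatim from `SketchIdeator2.lean` -/

/-- Card `recycle-track-shoot`'s codimension-0 exit stub at `θ = 1` (verbatim copy). -/
def HeteroclinicRigidityNS : Prop :=
  ∀ (M : ℝ) (U W : ℝ → ℝ³ → ℝ³),
    IsAncientMildSolution 1 U → IsAncientMildSolution 1 W →
    ContDiffOn ℝ (⊤ : ℕ∞) (uncurry U) (Iio 0 ×ˢ univ) → ContDiffOn ℝ (⊤ : ℕ∞) (uncurry W) (Iio 0 ×ˢ univ) →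
    HasTypeITimeDecay M U → HasTypeITimeDecay M W → (¬ ∀ t < 0, ∀ x, U t x = 0) →
    (∃ c : ℕ → ℝ, (∀ k, 0 < c k) ∧ Tendsto c atTop (𝓝 0) ∧
      ∀ K : Set (ℝ × ℝ³), IsCompact K → K ⊆ Iio 0 ×ˢ univ →
        TendstoUniformlyOn (fun k z => nsRescale (c k) W z.1 z.2) (uncurry U) atTop K) →
    ∃ (a : ℝ³) (τ γ : ℝ), 0 < γ ∧ ∀ t : ℝ, ∀ x : ℝ³, γ ^ 2 * t + τ < 0 →
      W t x = γ • U (γ ^ 2 * t + τ) (γ • x + a)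

/-- Card `closed-shadow`'s transferred stub at `θ = 1` (verbatim copy). -/
def IgnitionWithLossNS : Prop :=
  ∀ (M : ℝ) (U : ℝ → ℝ³ → ℝ³), IsAncientMildSolution 1 U →
    ContDiffOn ℝ (⊤ : ℕ∞) (uncurry U) (Iio 0 ×ˢ univ) → HasTypeITimeDecay M U →
    (¬ ∀ t < 0, ∀ x, U t x = 0) → ∀ η : ℝ, 0 < η →
    ∃ u₀ : SchwartzMap ℝ³ ℝ³, VectorCalculus.IsDivFree ⇑u₀ ∧ ∃ S : ℝ, 0 < S ∧ ∃ u : ℝ → L2C,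
      IsMildSolutionFor eulerForm (schwartzL2 u₀) (Ico 0 S) u ∧
      (∀ t ∈ Ico 0 S, eLpNorm (u t) ⊤ volume ≤ ENNReal.ofReal ((M + η) / Real.sqrt (S - t))) ∧
      ¬ ∃ S' : ℝ, S < S' ∧ ∃ v : ℝ → L2C,
        IsMildSolutionFor eulerForm (schwartzL2 u₀) (Ico 0 S') v ∧ ∀ t ∈ Ico 0 S, v t = u t

/-! ### The parasitic drifts -/

/-- The unit vectors `e₀`, `e₁`. -/
def e₀ : ℝ³ := EuclideanSpace.single 0 1
def e₁ : ℝ³ := EuclideanSpace.single 1 1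

theorem norm_e₀ : ‖e₀‖ = 1 := by simp [e₀]
theorem norm_e₁ : ‖e₁‖ = 1 := by simp [e₁]

theorem e₀_ne_zero : e₀ ≠ 0 := by
  intro h; have := norm_e₀; rw [h, norm_zero] at this; exact zero_ne_one this

theorem e₀_apply_one : e₀ 1 = 0 := by simp [e₀]
theorem e₁_apply_one : e₁ 1 = 1 := by simp [e₁]

/-- KNSS's parasitic drift at temperature `a`: `(a/√(−t)) e₀` (junk `0` for `t ≥ 0`). -/
def sdrift (a : ℝ) : ℝ → ℝ³ → ℝ³ := fun t _ => (a * (Real.sqrt (-t))⁻¹) • e₀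

/-- The perturbed drift `(−t)^{-1/2} e₀ + (1−t)^{-1/2} e₁`. -/
def pdrift : ℝ → ℝ³ → ℝ³ := fun t _ => (Real.sqrt (-t))⁻¹ • e₀ + (Real.sqrt (1 - t))⁻¹ • e₁

theorem sdrift_isAncientMild (a : ℝ) : IsAncientMildSolution 1 (sdrift a) :=
  isAncientMildSolution_timeConst 1 fun t => (a * (Real.sqrt (-t))⁻¹) • e₀

theorem pdrift_isAncientMild : IsAncientMildSolution 1 pdrift :=
  isAncientMildSolution_timeConst 1 fun t => (Real.sqrt (-t))⁻¹ • e₀ + (Real.sqrt (1 - t))⁻¹ • e₁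

/-- `p ↦ (−p.1)^{-1/2}` is smooth on `t < 0`. -/
theorem contDiffOn_inv_sqrt_neg :
    ContDiffOn ℝ (⊤ : ℕ∞) (fun p : ℝ × ℝ³ => (Real.sqrt (-p.1))⁻¹) (Iio 0 ×ˢ univ) := by
  refine ContDiffOn.inv ?_ ?_
  · refine ContDiffOn.sqrt contDiff_fst.neg.contDiffOn ?_
    rintro ⟨t, x⟩ ⟨ht, -⟩
    simp only [mem_Iio] at ht
    exact (neg_pos.2 ht).ne'
  · rintro ⟨t, x⟩ ⟨ht, -⟩
    simp only [mem_Iio] at ht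
    exact (Real.sqrt_pos.2 (neg_pos.2 ht)).ne'

/-- `p ↦ (1 − p.1)^{-1/2}` is smooth on `t < 0`. -/
theorem contDiffOn_inv_sqrt_one_sub :
    ContDiffOn ℝ (⊤ : ℕ∞) (fun p : ℝ × ℝ³ => (Real.sqrt (1 - p.1))⁻¹) (Iio 0 ×ˢ univ) := by
  refine ContDiffOn.inv ?_ ?_
  · refine ContDiffOn.sqrt (contDiff_const.sub contDiff_fst).contDiffOn ?_
    rintro ⟨t, x⟩ ⟨ht, -⟩
    simp only [mem_Iio] at ht
    show (1 : ℝ) - t ≠ 0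
    linarith
  · rintro ⟨t, x⟩ ⟨ht, -⟩
    simp only [mem_Iio] at ht
    exact (Real.sqrt_pos.2 (by show (0 : ℝ) < 1 - t; linarith)).ne'

theorem sdrift_smooth (a : ℝ) : ContDiffOn ℝ (⊤ : ℕ∞) (uncurry (sdrift a)) (Iio 0 ×ˢ univ) :=
  (contDiffOn_const.mul contDiffOn_inv_sqrt_neg).smul contDiffOn_const

theorem pdrift_smooth : ContDiffOn ℝ (⊤ : ℕ∞) (uncurry pdrift) (Iio 0 ×ˢ univ) :=
  (contDiffOn_inv_sqrt_neg.smul contDiffOn_const).add (contDiffOn_inv_sqrt_one_sub.smul contDiffOn_const)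

theorem norm_sdrift {a : ℝ} (ha : 0 ≤ a) (t : ℝ) (x : ℝ³) : ‖sdrift a t x‖ = a * (Real.sqrt (-t))⁻¹ := by
  rw [sdrift, norm_smul, norm_e₀, mul_one, Real.norm_eq_abs,
    abs_of_nonneg (mul_nonneg ha (inv_nonneg.2 (Real.sqrt_nonneg _)))]

theorem sdrift_typeI {a M : ℝ} (ha : 0 ≤ a) (haM : a ≤ M) : HasTypeITimeDecay M (sdrift a) := by
  intro t _ x
  rw [norm_sdrift ha, div_eq_mul_inv]
  exact mul_le_mul_of_nonneg_right haM (inv_nonneg.2 (Real.sqrt_nonneg _))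

theorem sdrift_nontrivial {a : ℝ} (ha : a ≠ 0) : ¬ ∀ t < 0, ∀ x, sdrift a t x = 0 := by
  intro h
  have := h (-1) (by norm_num) 0
  simp [sdrift, e₀_ne_zero, ha] at this

theorem pdrift_typeI : HasTypeITimeDecay 2 pdrift := by
  intro t ht x
  have h0 : 0 < Real.sqrt (-t) := Real.sqrt_pos.2 (by linarith)
  have h1 : Real.sqrt (-t) ≤ Real.sqrt (1 - t) := Real.sqrt_le_sqrt (by linarith)
  have h2 : (Real.sqrt (1 - t))⁻¹ ≤ (Real.sqrt (-t))⁻¹ := inv_anti₀ h0 h1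
  calc ‖pdrift t x‖ ≤ ‖(Real.sqrt (-t))⁻¹ • e₀‖ + ‖(Real.sqrt (1 - t))⁻¹ • e₁‖ := norm_add_le _ _
    _ = (Real.sqrt (-t))⁻¹ + (Real.sqrt (1 - t))⁻¹ := by
        rw [norm_smul, norm_smul, norm_e₀, norm_e₁, mul_one, mul_one, Real.norm_eq_abs, Real.norm_eq_abs,
          abs_of_nonneg (inv_nonneg.2 (Real.sqrt_nonneg _)), abs_of_nonneg (inv_nonneg.2 (Real.sqrt_nonneg _))]
    _ ≤ (Real.sqrt (-t))⁻¹ + (Real.sqrt (-t))⁻¹ := by linarith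
    _ = 2 / Real.sqrt (-t) := by ring

/-- Zoom-in of the perturbed drift: `c · pdrift (c² t, c x) = (−t)^{-1/2} e₀ + c (1 − c² t)^{-1/2} e₁` for
`t < 0`, `c > 0`. -/
theorem nsRescale_pdrift {c t : ℝ} (hc : 0 < c) (ht : t < 0) (x : ℝ³) :
    nsRescale c pdrift t x = (Real.sqrt (-t))⁻¹ • e₀ + (c * (Real.sqrt (1 - c ^ 2 * t))⁻¹) • e₁ := by
  rw [nsRescale_apply]
  simp only [pdrift]
  have hs : Real.sqrt (-(c ^ 2 * t)) = c * Real.sqrt (-t) := by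
    rw [show -(c ^ 2 * t) = c ^ 2 * (-t) by ring, Real.sqrt_mul (sq_nonneg c), Real.sqrt_sq hc.le]
  have h0 : Real.sqrt (-t) ≠ 0 := (Real.sqrt_pos.2 (by linarith)).ne'
  rw [smul_add, smul_smul, smul_smul, hs, mul_inv, ← mul_assoc, mul_inv_cancel₀ hc.ne', one_mul]

/-- The perturbed drift emanates from the drift in the typed sense: uniformly on `t < 0`. -/
theorem pdrift_emanates :
    ∃ c : ℕ → ℝ, (∀ k, 0 < c k) ∧ Tendsto c atTop (𝓝 0) ∧
      ∀ K : Set (ℝ × ℝ³), IsCompact K → K ⊆ Iio 0 ×ˢ univ →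
        TendstoUniformlyOn (fun k z => nsRescale (c k) pdrift z.1 z.2) (uncurry (sdrift 1)) atTop K := by
  refine ⟨fun k => 1 / ((k : ℝ) + 1), fun k => by positivity, tendsto_one_div_add_atTop_nhds_zero_nat,
    fun K _ hK => ?_⟩
  rw [Metric.tendstoUniformlyOn_iff]
  intro ε hε
  filter_upwards [(tendsto_one_div_add_atTop_nhds_zero_nat.eventually (gt_mem_nhds hε))] with k hk z hz
  have hz0 : z.1 < 0 := (mem_prod.1 (hK hz)).1
  have hc : (0 : ℝ) < 1 / ((k : ℝ) + 1) := by positivity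
  rw [nsRescale_pdrift hc hz0]
  simp only [uncurry, sdrift, one_mul]
  rw [dist_eq_norm, sub_add_cancel_left, norm_neg, norm_smul, norm_e₁, mul_one, Real.norm_eq_abs,
    abs_of_nonneg (mul_nonneg hc.le (inv_nonneg.2 (Real.sqrt_nonneg _)))]
  have h1 : 1 ≤ Real.sqrt (1 - (1 / ((k : ℝ) + 1)) ^ 2 * z.1) := by
    rw [← Real.sqrt_one]
    refine Real.sqrt_le_sqrt ?_
    nlinarith [sq_nonneg (1 / ((k : ℝ) + 1))]
  calc 1 / ((k : ℝ) + 1) * (Real.sqrt (1 - (1 / ((k : ℝ) + 1)) ^ 2 * z.1))⁻¹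
      ≤ 1 / ((k : ℝ) + 1) * 1 := by
        refine mul_le_mul_of_nonneg_left ?_ hc.le
        exact inv_le_one_of_one_le₀ h1
    _ < ε := by rw [mul_one]; exact hk

/-! ### The kills -/

/-- **`HeteroclinicRigidityNS` is false as typed** (junk model: parasitic drifts). [folklore] -/
theorem not_heteroclinicRigidityNS : ¬ HeteroclinicRigidityNS := by
  intro hR
  obtain ⟨a, τ, γ, hγ, hW⟩ := hR 2 (sdrift 1) pdrift (sdrift_isAncientMild 1) pdrift_isAncientMild
    (sdrift_smooth 1) pdrift_smooth (sdrift_typeI zero_le_one one_le_two) pdrift_typeI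
    (sdrift_nontrivial one_ne_zero) pdrift_emanates
  -- an admissible time: t₀ < 0 and γ² t₀ + τ < 0
  set t₀ : ℝ := min (-1) ((-τ - 1) / γ ^ 2) with ht₀
  have hγ2 : 0 < γ ^ 2 := by positivity
  have h1 : t₀ ≤ -1 := min_le_left _ _
  have h2 : γ ^ 2 * t₀ + τ < 0 := by
    have h3 : t₀ ≤ (-τ - 1) / γ ^ 2 := min_le_right _ _
    have h4 : γ ^ 2 * t₀ ≤ -τ - 1 := by
      calc γ ^ 2 * t₀ ≤ γ ^ 2 * ((-τ - 1) / γ ^ 2) := mul_le_mul_of_nonneg_left h3 hγ2.le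
        _ = -τ - 1 := by field_simp
    linarith
  have key := congr_fun (congr_arg (⇑) (hW t₀ 0 h2)) 1
  -- the `e₁`-coordinate: `(1 - t₀)^{-1/2} = 0`, absurd
  simp only [pdrift, sdrift, PiLp.add_apply, PiLp.smul_apply, smul_eq_mul, e₀_apply_one, e₁_apply_one,
    mul_zero, mul_one, zero_add] at key
  have h5 : 0 < Real.sqrt (1 - t₀) := Real.sqrt_pos.2 (by linarith)
  exact (inv_pos.2 h5).ne' key

/-- **`IgnitionWithLossNS` is false as typed**: igniting a cold parasitic drift contradicts Leray's
temperature floor in Tao's mild class (`typeI_constant_ge`). [folklore] -/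
theorem not_ignitionWithLossNS : ¬ IgnitionWithLossNS := by
  intro hI
  obtain ⟨c, hc, hfloor⟩ :=
    Summit.NavierStokesRegularity.NavierStokesRegularity.Theorems.BoundedTemperatureClosed.Negative.typeI_constant_ge
  have ha : 0 < c / 4 := by positivity
  obtain ⟨u₀, hdiv, S, hS, u, hu, hrate, hno⟩ :=
    hI (c / 4) (sdrift (c / 4)) (sdrift_isAncientMild _) (sdrift_smooth _) (sdrift_typeI ha.le le_rfl)
      (sdrift_nontrivial ha.ne') (c / 4) ha
  have h := hfloor (c / 4 + c / 4) u₀ hdiv S hS u hu hrate hno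
  linarith

end Summit.NavierStokesRegularity.NavierStokesRegularity.Cruxes.BoundedTemperatureClosed.TriageR1K1

end
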